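import Literature.NumberTheory.LFunctions.KloostermanFractionsDiagonal
import HarnessLib

/-!
# Kloosterman fractions: counting tools for the off-diagonal (pair expansion, class counts)

Tools for §4.1.2–4.1.3 of Bettin–Chandee (arXiv:1502.00769) in the simplified form used in
this series (amplifier `A = 1`, prime `ℓ₂` kept outside the Cauchy–Schwarz inequality):

* `kfc_expand_sq_le` — opening the square `|Σ_{(ℓ₁,d)} …|²` into pairs `((ℓ₁,d),(ℓ₁',d'))`
  and bringing the `n₂`-sum inside ("we now apply Cauchy–Schwarz's inequality … and open the
  square", B–C before (4.6));
* `kfc_diag_count` — the trivial count for a diagonal pair `(ℓ₁,d) = (ℓ₁',d')`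
  (`m = (ℓ₁n₁ - ℓ₂n₂)/d` lies in one class modulo `ℓ₂`);
* `kfc_card_lincong_le` — "there are at most `u := (d - d', b)` admissible classes `c`"
  (B–C (4.8)–(4.9): `c(d-d') ≡ (ℓ₁-ℓ₁')n₁ (mod b)`);
* `kfc_pair_weight_le` — the resulting weighted pair count
  `Σ_{(ℓ₁,d)≠(ℓ₁',d')} [u ∣ ℓ₁-ℓ₁'] u λ ≪ τ(b) L² D²`.

All statements are explicit finite inequalities; no asymptotic notation.

## References
* S. Bettin, V. Chandee, *Trilinear forms with Kloosterman fractions*, Adv. Math. 328 (2018),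
  arXiv:1502.00769, §4.1. [cite: BettinChandee2018, §4.1]
* W. Duke, J. Friedlander, H. Iwaniec, *Bilinear forms with Kloosterman fractions*,
  Invent. Math. 128 (1997) 23–43, §§3–4. [cite: DukeFriedlanderIwaniec1997, §3]
-/

noncomputable section

open scoped BigOperators
open Finset

namespace Literature.NumberTheory.LFunctions

/-! ### Opening the square -/

/-- `‖Σ_p G p‖² = Re Σ_{p,p'} G p · conj (G p')`. [folklore] -/
theorem kfc_norm_sq_sum_eq_re {ι : Type*} (P : Finset ι) (G : ι → ℂ) :
    ‖∑ p ∈ P, G p‖ ^ 2 = (∑ p ∈ P, ∑ p' ∈ P, G p * (starRingEnd ℂ) (G p')).re := by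
  have h : (∑ p ∈ P, G p) * (starRingEnd ℂ) (∑ p ∈ P, G p) =
      ∑ p ∈ P, ∑ p' ∈ P, G p * (starRingEnd ℂ) (G p') := by
    rw [map_sum, Finset.sum_mul_sum]
  rw [← h, Complex.mul_conj, Complex.ofReal_re, Complex.normSq_eq_norm_sq]

/-- **Opening the square in the off-diagonal dispersion** (B–C §4.1.2 with `ℓ₂` outside):
`Σ_{n₂,c} |Σ_{ℓ₁}[NDC] Σ_d [A] E|² ≤ Σ_{(ℓ₁,d),(ℓ₁',d')} Σ_c |Σ_{n₂} [NDC∧NDC'][A∧A'] E conj E'|`.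
[cite: BettinChandee2018, §4.1.2] -/
theorem kfc_expand_sq_le (𝓛 T₂ Cb : Finset ℕ) (Dset : Finset ℤ) (NDC : ℕ → ℕ → Prop)
    [∀ l n, Decidable (NDC l n)] (A : ℕ → ℤ → ℕ → ℕ → Prop) [∀ l d c n, Decidable (A l d c n)]
    (E : ℕ → ℤ → ℕ → ℂ) :
    ∑ n₂ ∈ T₂, ∑ c ∈ Cb, ‖∑ ℓ₁ ∈ 𝓛, (if NDC ℓ₁ n₂ then
        ∑ d ∈ Dset, (if A ℓ₁ d c n₂ then E ℓ₁ d n₂ else 0) else 0)‖ ^ 2 ≤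
    ∑ ℓ₁ ∈ 𝓛, ∑ d ∈ Dset, ∑ ℓ₁' ∈ 𝓛, ∑ d' ∈ Dset, ∑ c ∈ Cb,
      ‖∑ n₂ ∈ T₂, (if (NDC ℓ₁ n₂ ∧ NDC ℓ₁' n₂) then
        (if (A ℓ₁ d c n₂ ∧ A ℓ₁' d' c n₂) then E ℓ₁ d n₂ * (starRingEnd ℂ) (E ℓ₁' d' n₂) else 0)
        else 0)‖ := by
  classical
  set G : ℕ × ℤ → ℕ → ℕ → ℂ := fun p c n₂ =>
    if NDC p.1 n₂ then (if A p.1 p.2 c n₂ then E p.1 p.2 n₂ else 0) else 0 with hG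
  set P := 𝓛 ×ˢ Dset with hP
  have hV : ∀ c n₂, ∑ ℓ₁ ∈ 𝓛, (if NDC ℓ₁ n₂ then
      ∑ d ∈ Dset, (if A ℓ₁ d c n₂ then E ℓ₁ d n₂ else 0) else 0) = ∑ p ∈ P, G p c n₂ := by
    intro c n₂
    rw [hP, Finset.sum_product]
    refine Finset.sum_congr rfl fun ℓ₁ _ => ?_
    by_cases h : NDC ℓ₁ n₂
    · rw [if_pos h]
      refine Finset.sum_congr rfl fun d _ => ?_
      simp only [hG, if_pos h]
    · rw [if_neg h]
      symm
      refine Finset.sum_eq_zero fun d _ => ?_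
      simp only [hG, if_neg h]
  have hpair : ∀ (p p' : ℕ × ℤ) c n₂, G p c n₂ * (starRingEnd ℂ) (G p' c n₂) =
      (if (NDC p.1 n₂ ∧ NDC p'.1 n₂) then (if (A p.1 p.2 c n₂ ∧ A p'.1 p'.2 c n₂) then
        E p.1 p.2 n₂ * (starRingEnd ℂ) (E p'.1 p'.2 n₂) else 0) else 0) := by
    intro p p' c n₂
    simp only [hG]
    by_cases h1 : NDC p.1 n₂ <;> by_cases h2 : NDC p'.1 n₂ <;>
      by_cases h3 : A p.1 p.2 c n₂ <;> by_cases h4 : A p'.1 p'.2 c n₂ <;> simp [h1, h2, h3, h4]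
  have hcomm : ∑ n₂ ∈ T₂, ∑ c ∈ Cb, ∑ p ∈ P, ∑ p' ∈ P, G p c n₂ * (starRingEnd ℂ) (G p' c n₂) =
      ∑ p ∈ P, ∑ p' ∈ P, ∑ c ∈ Cb, ∑ n₂ ∈ T₂, G p c n₂ * (starRingEnd ℂ) (G p' c n₂) := by
    calc ∑ n₂ ∈ T₂, ∑ c ∈ Cb, ∑ p ∈ P, ∑ p' ∈ P, G p c n₂ * (starRingEnd ℂ) (G p' c n₂)
        = ∑ n₂ ∈ T₂, ∑ p ∈ P, ∑ p' ∈ P, ∑ c ∈ Cb, G p c n₂ * (starRingEnd ℂ) (G p' c n₂) := by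
          refine Finset.sum_congr rfl fun n₂ _ => ?_
          calc ∑ c ∈ Cb, ∑ p ∈ P, ∑ p' ∈ P, G p c n₂ * (starRingEnd ℂ) (G p' c n₂)
              = ∑ p ∈ P, ∑ c ∈ Cb, ∑ p' ∈ P, G p c n₂ * (starRingEnd ℂ) (G p' c n₂) :=
                Finset.sum_comm
            _ = ∑ p ∈ P, ∑ p' ∈ P, ∑ c ∈ Cb, G p c n₂ * (starRingEnd ℂ) (G p' c n₂) :=
                Finset.sum_congr rfl fun p _ => Finset.sum_comm
      _ = ∑ p ∈ P, ∑ n₂ ∈ T₂, ∑ p' ∈ P, ∑ c ∈ Cb, G p c n₂ * (starRingEnd ℂ) (G p' c n₂) :=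
          Finset.sum_comm
      _ = ∑ p ∈ P, ∑ p' ∈ P, ∑ n₂ ∈ T₂, ∑ c ∈ Cb, G p c n₂ * (starRingEnd ℂ) (G p' c n₂) :=
          Finset.sum_congr rfl fun p _ => Finset.sum_comm
      _ = _ := Finset.sum_congr rfl fun p _ => Finset.sum_congr rfl fun p' _ => Finset.sum_comm
  calc ∑ n₂ ∈ T₂, ∑ c ∈ Cb, ‖∑ ℓ₁ ∈ 𝓛, (if NDC ℓ₁ n₂ then
          ∑ d ∈ Dset, (if A ℓ₁ d c n₂ then E ℓ₁ d n₂ else 0) else 0)‖ ^ 2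
      = ∑ n₂ ∈ T₂, ∑ c ∈ Cb,
          (∑ p ∈ P, ∑ p' ∈ P, G p c n₂ * (starRingEnd ℂ) (G p' c n₂)).re := by
        refine Finset.sum_congr rfl fun n₂ _ => Finset.sum_congr rfl fun c _ => ?_
        rw [hV, kfc_norm_sq_sum_eq_re]
    _ = (∑ p ∈ P, ∑ p' ∈ P, ∑ c ∈ Cb, ∑ n₂ ∈ T₂, G p c n₂ * (starRingEnd ℂ) (G p' c n₂)).re := by
        rw [← hcomm, Complex.re_sum]
        refine Finset.sum_congr rfl fun n₂ _ => ?_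
        rw [Complex.re_sum]
    _ ≤ ‖∑ p ∈ P, ∑ p' ∈ P, ∑ c ∈ Cb, ∑ n₂ ∈ T₂, G p c n₂ * (starRingEnd ℂ) (G p' c n₂)‖ :=
        Complex.re_le_norm _
    _ ≤ ∑ p ∈ P, ∑ p' ∈ P, ∑ c ∈ Cb, ‖∑ n₂ ∈ T₂, G p c n₂ * (starRingEnd ℂ) (G p' c n₂)‖ := by
        refine (norm_sum_le _ _).trans (Finset.sum_le_sum fun p _ => ?_)
        refine (norm_sum_le _ _).trans (Finset.sum_le_sum fun p' _ => ?_)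
        exact norm_sum_le _ _
    _ = _ := by
        rw [hP, Finset.sum_product]
        refine Finset.sum_congr rfl fun ℓ₁ _ => Finset.sum_congr rfl fun d _ => ?_
        rw [Finset.sum_product]
        refine Finset.sum_congr rfl fun ℓ₁' _ => Finset.sum_congr rfl fun d' _ =>
          Finset.sum_congr rfl fun c _ => ?_
        congr 1
        exact Finset.sum_congr rfl fun n₂ _ => hpair _ _ _ _

/-! ### Counting in residue classes -/

/-- The number of integers `a < x ≤ c` in a residue class modulo `r ≥ 1` is at most
`(c - a)/r + 1`. [folklore] -/
theorem kfc_card_Ioc_modEq_le (a c : ℤ) (hac : a ≤ c) {r : ℤ} (hr : 0 < r) (v : ℤ) :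
    ((((Finset.Ioc a c).filter (fun x => x ≡ v [ZMOD r])).card : ℕ) : ℝ) ≤
      ((c : ℝ) - a) / r + 1 := by
  have h := Int.Ioc_filter_modEq_card a c hr v
  set n := ((Finset.Ioc a c).filter (fun x => x ≡ v [ZMOD r])).card with hn
  set B : ℚ := ((c : ℚ) - v) / r with hB
  set A : ℚ := ((a : ℚ) - v) / r with hA
  have hr' : (0 : ℚ) < r := by exact_mod_cast hr
  have hBA : B - A = ((c : ℚ) - a) / r := by
    rw [hB, hA, div_sub_div_same]
    congr 1; ring
  have hca : (0 : ℚ) ≤ ((c : ℚ) - a) / r :=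
    div_nonneg (by exact_mod_cast sub_nonneg.mpr hac) hr'.le
  have key : ((max (⌊B⌋ - ⌊A⌋) 0 : ℤ) : ℚ) ≤ ((c : ℚ) - a) / r + 1 := by
    rcases le_or_gt (⌊B⌋ - ⌊A⌋) 0 with h0 | h0
    · rw [max_eq_right h0]; push_cast; linarith
    · rw [max_eq_left h0.le]; push_cast
      have h1 := Int.floor_le B
      have h2 := Int.lt_floor_add_one A
      linarith
  have key' : ((n : ℤ) : ℚ) ≤ ((c : ℚ) - a) / r + 1 := by rw [h]; exact key
  have key'' : (((n : ℤ) : ℚ) : ℝ) ≤ ((((c : ℚ) - a) / r + 1 : ℚ) : ℝ) := by exact_mod_cast key'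
  push_cast at key''
  exact key''

/-- **Trivial count for a diagonal pair** `(ℓ₁,d) = (ℓ₁',d')` (B–C §4.1.2, the terms with
`Δ = 0`): for fixed `ℓ₁ ≠ ℓ₂`, `n₁`, `d ≠ 0`, the number of pairs `(c, n₂)` with
`(n₁n₂, ℓ₁ℓ₂) = 1`, `d ∣ w := ℓ₁n₁ - ℓ₂n₂`, `M₁ < w/d ≤ M₂`, `w/d ≡ c (mod b)` is at most the
number of `m = w/d ∈ (M₁, M₂]` in the class `m d ≡ ℓ₁ n₁ (mod ℓ₂)`, i.e. at most
`(M₂ - M₁)/ℓ₂ + 1`.  Stated for the `n₂`-sums of unimodular terms `F`.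
[cite: BettinChandee2018, §4.1.2] -/
theorem kfc_diag_count (b : ℕ) {ℓ₁ ℓ₂ : ℕ} (hp₁ : ℓ₁.Prime) (hp₂ : ℓ₂.Prime)
    (n₁ : ℕ) (d : ℤ) {M₁ M₂ : ℕ} (hM : M₁ ≤ M₂) (T₂ : Finset ℕ)
    (NDC : ℕ → Prop) [DecidablePred NDC]
    (hNDC : ∀ n₂, NDC n₂ → ℓ₁ ≠ ℓ₂ ∧ (n₁ * n₂).Coprime (ℓ₁ * ℓ₂)) (F : ℕ → ℂ)
    (hF : ∀ n, ‖F n‖ ≤ 1) :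
    ∑ c ∈ (Finset.range b).filter (fun c => c.Coprime b),
      ‖∑ n₂ ∈ T₂, (if NDC n₂ then
        (if (d ∣ ((ℓ₁ * n₁ : ℤ) - ℓ₂ * n₂) ∧ (M₁ : ℤ) < ((ℓ₁ * n₁ : ℤ) - ℓ₂ * n₂) / d ∧
            ((ℓ₁ * n₁ : ℤ) - ℓ₂ * n₂) / d ≤ M₂ ∧ ((ℓ₁ * n₁ : ℤ) - ℓ₂ * n₂) / d ≡ (c : ℤ) [ZMOD b])
          then F n₂ else 0) else 0)‖ ≤ ((M₂ : ℝ) - M₁) / ℓ₂ + 1 := by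
  classical
  set Cb := (Finset.range b).filter (fun c => c.Coprime b) with hCb
  set w : ℕ → ℤ := fun n₂ => (ℓ₁ * n₁ : ℤ) - ℓ₂ * n₂ with hw
  set A : ℕ → ℕ → Prop := fun c n₂ => d ∣ w n₂ ∧ (M₁ : ℤ) < w n₂ / d ∧ w n₂ / d ≤ M₂ ∧
    w n₂ / d ≡ (c : ℤ) [ZMOD b] with hA
  set S := (Cb ×ˢ T₂).filter (fun q => NDC q.2 ∧ A q.1 q.2) with hS
  -- Step 1: each `n₂`-sum is bounded by a count
  have h1 : ∀ c, ‖∑ n₂ ∈ T₂, (if NDC n₂ then (if A c n₂ then F n₂ else 0) else 0)‖ ≤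
      ((T₂.filter (fun n₂ => NDC n₂ ∧ A c n₂)).card : ℝ) := by
    intro c
    refine (norm_sum_le _ _).trans ?_
    have : ∀ n₂ ∈ T₂, ‖(if NDC n₂ then (if A c n₂ then F n₂ else 0) else 0)‖ ≤
        (if (NDC n₂ ∧ A c n₂) then (1 : ℝ) else 0) := by
      intro n₂ _
      by_cases hN : NDC n₂ <;> by_cases hAc : A c n₂ <;> simp [hN, hAc, hF]
    refine (Finset.sum_le_sum this).trans ?_
    rw [Finset.sum_boole]
  -- Step 2: the total count is `#S`
  have h2 : ∑ c ∈ Cb, ((T₂.filter (fun n₂ => NDC n₂ ∧ A c n₂)).card : ℝ) = (S.card : ℝ) := by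
    rw [hS, Finset.card_filter, Finset.sum_product]
    push_cast
    refine Finset.sum_congr rfl fun c _ => ?_
    rw [Finset.card_filter]
    push_cast
    rfl
  -- Step 3: `S` injects into one residue class of `m ∈ (M₁, M₂]` modulo `ℓ₂`
  have h3 : (S.card : ℝ) ≤ ((M₂ : ℝ) - M₁) / ℓ₂ + 1 := by
    rcases S.eq_empty_or_nonempty with hS0 | ⟨q₀, hq₀⟩
    · rw [hS0, Finset.card_empty, Nat.cast_zero]
      have hM' : (M₁ : ℝ) ≤ M₂ := by exact_mod_cast hM
      have : (0 : ℝ) ≤ ((M₂ : ℝ) - M₁) / ℓ₂ := div_nonneg (sub_nonneg.mpr hM') (Nat.cast_nonneg _)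
      linarith
    · have hq₀' := (Finset.mem_filter.mp hq₀).2
      obtain ⟨hne, hcop⟩ := hNDC _ hq₀'.1
      haveI : Fact ℓ₂.Prime := ⟨hp₂⟩
      -- `ℓ₂ ∤ ℓ₁ n₁`
      have hℓ₂n : ((ℓ₁ * n₁ : ℕ) : ZMod ℓ₂) ≠ 0 := by
        rw [Ne, ZMod.natCast_eq_zero_iff]
        intro hdiv
        rcases (Nat.Prime.dvd_mul hp₂).mp hdiv with h | h
        · exact hne ((Nat.prime_dvd_prime_iff_eq hp₂ hp₁).mp h).symm
        · have : ℓ₂ ∣ Nat.gcd (n₁ * q₀.2) (ℓ₁ * ℓ₂) :=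
            Nat.dvd_gcd (dvd_mul_of_dvd_left h _) (dvd_mul_left _ _)
          rw [hcop] at this
          exact hp₂.one_lt.ne' (Nat.dvd_one.mp this)
      -- `ℓ₂ ∤ d`
      have hdunit : ((d : ℤ) : ZMod ℓ₂) ≠ 0 := by
        intro hd0
        rw [ZMod.intCast_zmod_eq_zero_iff_dvd] at hd0
        have hdw : d ∣ w q₀.2 := hq₀'.2.1
        have : (ℓ₂ : ℤ) ∣ (ℓ₁ * n₁ : ℤ) := by
          have h1 : (ℓ₂ : ℤ) ∣ w q₀.2 := hd0.trans hdw
          have h2 : (ℓ₂ : ℤ) ∣ (ℓ₂ : ℤ) * q₀.2 := dvd_mul_right _ _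
          have := h1.add h2
          simpa [hw] using this
        apply hℓ₂n
        rw [ZMod.natCast_eq_zero_iff]
        exact_mod_cast Int.natCast_dvd_natCast.mp (by exact_mod_cast this)
      set m₀ : ℤ := (((((ℓ₁ * n₁ : ℕ) : ZMod ℓ₂) * ((d : ℤ) : ZMod ℓ₂)⁻¹).val : ℕ) : ℤ) with hm₀
      have hmaps : ∀ q ∈ S, w q.2 / d ∈ (Finset.Ioc (M₁ : ℤ) M₂).filter
          (fun x => x ≡ m₀ [ZMOD ℓ₂]) := by
        intro q hq
        have hq' := (Finset.mem_filter.mp hq).2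
        obtain ⟨hdw, hlo, hhi, _⟩ := hq'.2
        refine Finset.mem_filter.mpr ⟨Finset.mem_Ioc.mpr ⟨hlo, hhi⟩, ?_⟩
        have hmd : (w q.2 / d) * d = w q.2 := Int.ediv_mul_cancel hdw
        have hcast : ((w q.2 / d : ℤ) : ZMod ℓ₂) * ((d : ℤ) : ZMod ℓ₂) =
            ((ℓ₁ * n₁ : ℕ) : ZMod ℓ₂) := by
          have h := congrArg (fun z : ℤ => (z : ZMod ℓ₂)) hmd
          simp only [Int.cast_mul] at h
          rw [h, hw]
          push_cast
          rw [ZMod.natCast_self, zero_mul, sub_zero]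
        have hm : ((w q.2 / d : ℤ) : ZMod ℓ₂) =
            ((ℓ₁ * n₁ : ℕ) : ZMod ℓ₂) * ((d : ℤ) : ZMod ℓ₂)⁻¹ := by
          rw [← hcast, mul_assoc, mul_inv_cancel₀ hdunit, mul_one]
        refine (ZMod.intCast_eq_intCast_iff _ _ _).mp ?_
        rw [hm, hm₀, Int.cast_natCast, ZMod.natCast_zmod_val]
      have hinj : Set.InjOn (fun q : ℕ × ℕ => w q.2 / d) S := by
        intro q hq q' hq' heq
        have hqS : q ∈ S := by simpa using hq
        have hqS' : q' ∈ S := by simpa using hq'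
        have hq1 := Finset.mem_filter.mp hqS
        have hq1' := Finset.mem_filter.mp hqS'
        obtain ⟨hdw, _, _, hc⟩ := hq1.2.2
        obtain ⟨hdw', _, _, hc'⟩ := hq1'.2.2
        have heq' : w q.2 / d = w q'.2 / d := heq
        have hww : w q.2 = w q'.2 := by
          rw [← Int.ediv_mul_cancel hdw, ← Int.ediv_mul_cancel hdw', heq']
        have h2 : q.2 = q'.2 := by
          have h := hww
          simp only [hw] at h
          have hℓ₂0 : (ℓ₂ : ℤ) ≠ 0 := by exact_mod_cast hp₂.ne_zero
          have : (ℓ₂ : ℤ) * q.2 = (ℓ₂ : ℤ) * q'.2 := by linarith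
          exact_mod_cast mul_left_cancel₀ hℓ₂0 this
        have h1 : q.1 = q'.1 := by
          have hcb : q.1 < b := Finset.mem_range.mp (Finset.mem_filter.mp (Finset.mem_product.mp
            hq1.1).1).1
          have hcb' : q'.1 < b := Finset.mem_range.mp (Finset.mem_filter.mp (Finset.mem_product.mp
            hq1'.1).1).1
          have hcc : (q.1 : ℤ) ≡ (q'.1 : ℤ) [ZMOD b] := by
            have := hc.symm.trans (heq' ▸ hc')
            exact this
          have e1 : (q.1 : ℤ) % b = q.1 := Int.emod_eq_of_lt (by positivity) (by exact_mod_cast hcb)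
          have e2 : (q'.1 : ℤ) % b = q'.1 :=
            Int.emod_eq_of_lt (by positivity) (by exact_mod_cast hcb')
          have : (q.1 : ℤ) = q'.1 := by rw [← e1, ← e2]; exact hcc
          exact_mod_cast this
        exact Prod.ext h1 h2
      have hcard := Finset.card_le_card_of_injOn (fun q : ℕ × ℕ => w q.2 / d)
        (by intro q hq; exact hmaps q (by simpa using hq)) hinj
      have hcls := kfc_card_Ioc_modEq_le (M₁ : ℤ) (M₂ : ℤ) (by exact_mod_cast hM)
        (show (0 : ℤ) < ℓ₂ by exact_mod_cast hp₂.pos) m₀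
      push_cast at hcls
      calc (S.card : ℝ) ≤ (((Finset.Ioc (M₁ : ℤ) M₂).filter
            (fun x => x ≡ m₀ [ZMOD ℓ₂])).card : ℝ) := by exact_mod_cast hcard
        _ ≤ _ := hcls
  calc ∑ c ∈ Cb, ‖∑ n₂ ∈ T₂, (if NDC n₂ then (if A c n₂ then F n₂ else 0) else 0)‖
      ≤ ∑ c ∈ Cb, ((T₂.filter (fun n₂ => NDC n₂ ∧ A c n₂)).card : ℝ) :=
        Finset.sum_le_sum fun c _ => h1 c
    _ = (S.card : ℝ) := h2
    _ ≤ _ := h3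

/-! ### Admissible classes `c` -/

/-- **At most `(e, b)` solutions of a linear congruence** `c e ≡ r (mod b)` with `0 ≤ c < b`,
and none unless `(e,b) ∣ r` (B–C §4.1.2: "there are at most `u := (d-d', b)` possible values
for `c`"). [cite: BettinChandee2018, §4.1.2] -/
theorem kfc_card_lincong_le {b : ℕ} (hb : 0 < b) (e r : ℤ) :
    ((((Finset.range b).filter (fun c : ℕ => (c : ℤ) * e ≡ r [ZMOD b])).card : ℕ) : ℝ) ≤
      if ((Int.gcd e b : ℕ) : ℤ) ∣ r then (Int.gcd e b : ℝ) else 0 := by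
  classical
  set s := (Finset.range b).filter (fun c : ℕ => (c : ℤ) * e ≡ r [ZMOD b]) with hs
  set g : ℕ := Int.gcd e b with hg
  have hb0 : (b : ℤ) ≠ 0 := by exact_mod_cast hb.ne'
  have hg0 : 0 < g := Int.gcd_pos_of_ne_zero_right _ hb0
  have hge : (g : ℤ) ∣ e := Int.gcd_dvd_left e b
  have hgb : (g : ℤ) ∣ (b : ℤ) := Int.gcd_dvd_right e b
  rcases s.eq_empty_or_nonempty with h0 | ⟨c₀, hc₀⟩
  · rw [h0, Finset.card_empty, Nat.cast_zero]
    split_ifs <;> positivity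
  · have hc₀' := (Finset.mem_filter.mp hc₀).2
    have hgr : (g : ℤ) ∣ r := by
      have h3 : (b : ℤ) ∣ r - c₀ * e := Int.ModEq.dvd hc₀'
      have h4 : (g : ℤ) ∣ r - c₀ * e := hgb.trans h3
      have h5 : (g : ℤ) ∣ (c₀ : ℤ) * e := dvd_mul_of_dvd_right hge _
      have := h4.add h5
      simpa using this
    rw [if_pos hgr]
    -- `b = g b'`, `e = g e'`, `(b', e') = 1`
    have hgb' : g ∣ b := Int.natCast_dvd_natCast.mp hgb
    set b' : ℕ := b / g with hb'
    have hbg : b = g * b' := (Nat.mul_div_cancel' hgb').symm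
    have hb'0 : 0 < b' := Nat.pos_of_ne_zero (by rintro h; rw [h, mul_zero] at hbg; omega)
    set e' : ℤ := e / g with he'
    have heg : e = g * e' := (Int.mul_ediv_cancel' hge).symm
    have hcop : Int.gcd e' (b' : ℤ) = 1 := by
      have := Int.gcd_div_gcd_div_gcd hg0
      rw [← hg] at this
      have hbcast : (b : ℤ) / (g : ℤ) = (b' : ℤ) := by rw [hb']; exact (Int.natCast_div b g).symm
      rwa [hbcast] at this
    -- all solutions are congruent to `c₀` modulo `b'`
    have hcong : ∀ c ∈ s, c % b' = c₀ % b' := by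
      intro c hc
      have hc' := (Finset.mem_filter.mp hc).2
      have h1 : (b : ℤ) ∣ ((c₀ : ℤ) - c) * e' * g := by
        have := Int.ModEq.dvd (hc'.trans hc₀'.symm)
        have e1 : (c₀ : ℤ) * e - c * e = ((c₀ : ℤ) - c) * e' * g := by rw [heg]; ring
        rwa [e1] at this
      have h2 : (b' : ℤ) ∣ ((c₀ : ℤ) - c) * e' := by
        have : ((b' : ℤ) * g) ∣ ((c₀ : ℤ) - c) * e' * g := by
          have e2 : ((b' : ℤ) * g) = (b : ℤ) := by rw [hbg]; push_cast; ring
          rwa [e2]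
        exact (mul_dvd_mul_iff_right (by exact_mod_cast hg0.ne')).mp this
      have h3 : (b' : ℤ) ∣ ((c₀ : ℤ) - c) := by
        have hcop' : Int.gcd (b' : ℤ) e' = 1 := by rw [Int.gcd_comm]; exact hcop
        exact Int.dvd_of_dvd_mul_left_of_gcd_one h2 hcop'
      have h4 : (c : ℤ) % (b' : ℤ) = (c₀ : ℤ) % (b' : ℤ) :=
        Int.ModEq.eq (Int.modEq_of_dvd h3)
      have h5 : ((c % b' : ℕ) : ℤ) = ((c₀ % b' : ℕ) : ℤ) := by
        rw [Int.natCast_mod, Int.natCast_mod]; exact h4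
      exact_mod_cast h5
    -- injection `c ↦ c / b'` into `range g`
    have hmaps : ∀ c ∈ s, c / b' ∈ Finset.range g := by
      intro c hc
      have hcb : c < b := Finset.mem_range.mp (Finset.mem_filter.mp hc).1
      rw [Finset.mem_range, Nat.div_lt_iff_lt_mul hb'0]
      rw [hbg] at hcb
      linarith [Nat.mul_comm g b']
    have hinj : Set.InjOn (fun c : ℕ => c / b') s := by
      intro c hc c' hc' heq
      have h1 := hcong c (by simpa using hc)
      have h2 := hcong c' (by simpa using hc')
      have heq' : c / b' = c' / b' := heq
      rw [← Nat.div_add_mod c b', ← Nat.div_add_mod c' b', heq', h1, h2]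
    have hcard := Finset.card_le_card_of_injOn (fun c : ℕ => c / b')
      (by intro c hc; exact hmaps c (by simpa using hc)) hinj
    rw [Finset.card_range] at hcard
    exact_mod_cast hcard

/-- The two congruences `w/d ≡ c ≡ w'/d' (mod b)` with `w - w' = (ℓ₁ - ℓ₁') n₁` force
`c (d - d') ≡ (ℓ₁ - ℓ₁') n₁ (mod b)` (B–C (4.8)–(4.9), with `A = 1`).
[cite: BettinChandee2018, §4.1.2 (acafd)] -/
theorem kfc_adm_lincong {b ℓ₁ ℓ₁' ℓ₂ n₁ n₂ c : ℕ} {d d' : ℤ}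
    (hA : d ∣ ((ℓ₁ * n₁ : ℤ) - ℓ₂ * n₂) ∧
      ((ℓ₁ * n₁ : ℤ) - ℓ₂ * n₂) / d ≡ (c : ℤ) [ZMOD b])
    (hA' : d' ∣ ((ℓ₁' * n₁ : ℤ) - ℓ₂ * n₂) ∧
      ((ℓ₁' * n₁ : ℤ) - ℓ₂ * n₂) / d' ≡ (c : ℤ) [ZMOD b]) :
    (c : ℤ) * (d - d') ≡ ((ℓ₁ : ℤ) - ℓ₁') * n₁ [ZMOD b] := by
  obtain ⟨hdw, hc⟩ := hA
  obtain ⟨hdw', hc'⟩ := hA'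
  have h1 : ((ℓ₁ * n₁ : ℤ) - ℓ₂ * n₂) ≡ (c : ℤ) * d [ZMOD b] := by
    have := hc.mul_right d
    rwa [Int.ediv_mul_cancel hdw] at this
  have h2 : ((ℓ₁' * n₁ : ℤ) - ℓ₂ * n₂) ≡ (c : ℤ) * d' [ZMOD b] := by
    have := hc'.mul_right d'
    rwa [Int.ediv_mul_cancel hdw'] at this
  have h3 := h1.sub h2
  have e1 : ((ℓ₁ * n₁ : ℤ) - ℓ₂ * n₂) - ((ℓ₁' * n₁ : ℤ) - ℓ₂ * n₂) = ((ℓ₁ : ℤ) - ℓ₁') * n₁ := by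
    ring
  have e2 : (c : ℤ) * d - c * d' = (c : ℤ) * (d - d') := by ring
  rw [e1, e2] at h3
  exact h3.symm

/-- **Summing over the admissible classes**: if every nonzero `X c` forces the congruence
`c e ≡ r (mod b)` and `|X c| ≤ B`, then `Σ_{c coprime to b} |X c| ≤ [(e,b) ∣ r] (e,b) B`.
[cite: BettinChandee2018, §4.1.2] -/
theorem kfc_csum_le {b : ℕ} (hb : 0 < b) (e r : ℤ) (X : ℕ → ℂ) {B : ℝ} (hB : 0 ≤ B)
    (hXB : ∀ c, ‖X c‖ ≤ B) (hX0 : ∀ c, X c ≠ 0 → (c : ℤ) * e ≡ r [ZMOD b]) :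
    ∑ c ∈ (Finset.range b).filter (fun c => c.Coprime b), ‖X c‖ ≤
      (if ((Int.gcd e b : ℕ) : ℤ) ∣ r then (Int.gcd e b : ℝ) else 0) * B := by
  classical
  set s := (Finset.range b).filter (fun c : ℕ => (c : ℤ) * e ≡ r [ZMOD b]) with hs
  calc ∑ c ∈ (Finset.range b).filter (fun c => c.Coprime b), ‖X c‖
      = ∑ c ∈ ((Finset.range b).filter (fun c => c.Coprime b)).filter (fun c => X c ≠ 0),
          ‖X c‖ := by
        symm
        apply Finset.sum_filter_of_ne
        intro c _ hc h
        simp [h] at hc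
    _ ≤ ∑ c ∈ s, ‖X c‖ := by
        refine Finset.sum_le_sum_of_subset_of_nonneg ?_ (fun c _ _ => norm_nonneg _)
        intro c hc
        have hc' := Finset.mem_filter.mp hc
        exact Finset.mem_filter.mpr ⟨(Finset.mem_filter.mp hc'.1).1, hX0 c hc'.2⟩
    _ ≤ ∑ c ∈ s, B := Finset.sum_le_sum fun c _ => hXB c
    _ = (s.card : ℝ) * B := by rw [Finset.sum_const, nsmul_eq_mul]
    _ ≤ _ := mul_le_mul_of_nonneg_right (kfc_card_lincong_le hb e r) hB

/-! ### The weighted pair count -/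

/-- Reindexing a sum over naturals `N₁ ≤ n ≤ N₂` by integers. [folklore] -/
theorem kfc_sum_Icc_nat_eq_int (N₁ N₂ : ℕ) (F : ℤ → ℝ) :
    ∑ n ∈ Finset.Icc N₁ N₂, F (n : ℤ) = ∑ x ∈ Finset.Icc (N₁ : ℤ) (N₂ : ℤ), F x := by
  refine Finset.sum_nbij' (fun n : ℕ => (n : ℤ)) (fun x : ℤ => x.toNat) ?_ ?_ ?_ ?_ ?_
  · intro n hn
    simp only [Finset.mem_Icc] at hn ⊢
    exact ⟨by exact_mod_cast hn.1, by exact_mod_cast hn.2⟩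
  · intro x hx
    simp only [Finset.mem_Icc] at hx ⊢
    constructor <;> omega
  · intro n _; exact Int.toNat_natCast n
  · intro x hx
    simp only [Finset.mem_Icc] at hx
    exact Int.toNat_of_nonneg (by omega)
  · intro n _; rfl

/-- Reindexing a sum over `-N ≤ x ≤ -1` by `x = -n`, `1 ≤ n ≤ N`. [folklore] -/
theorem kfc_sum_Icc_neg_eq (N : ℕ) (F : ℤ → ℝ) :
    ∑ x ∈ Finset.Icc (-(N : ℤ)) (-1), F x = ∑ n ∈ Finset.Icc 1 N, F (-(n : ℤ)) := by
  symm
  refine Finset.sum_nbij' (fun n : ℕ => -(n : ℤ)) (fun x : ℤ => (-x).toNat) ?_ ?_ ?_ ?_ ?_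
  · intro n hn
    simp only [Finset.mem_Icc] at hn ⊢
    constructor <;> omega
  · intro x hx
    simp only [Finset.mem_Icc] at hx ⊢
    constructor <;> omega
  · intro n _; simp
  · intro x hx
    simp only [Finset.mem_Icc] at hx
    show -(((-x).toNat : ℕ) : ℤ) = x
    rw [Int.toNat_of_nonneg (by omega)]
    ring
  · intro n _; rfl

/-- `Σ_{0 < |x| ≤ N} (x, b) ≤ 2 τ(b) N` (from Matomäki–Merikoski Lemma 3.7(i),
`MatomakiMerikoski.MatomakiMerikoski2023_lemma37_i`). [folklore] -/
theorem kfc_sum_gcd_Icc_int_le {b : ℕ} (hb : 0 < b) (N : ℕ) :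
    ∑ x ∈ Finset.Icc (-(N : ℤ)) N, (if x = 0 then (0 : ℝ) else (Int.gcd x b : ℝ)) ≤
      2 * (b.divisors.card : ℝ) * N := by
  have hsplit : ∀ x : ℤ, (if x = 0 then (0 : ℝ) else (Int.gcd x b : ℝ)) =
      (if 0 < x then (Int.gcd x b : ℝ) else 0) + (if x < 0 then (Int.gcd x b : ℝ) else 0) := by
    intro x
    rcases lt_trichotomy x 0 with h | h | h
    · rw [if_neg h.ne, if_neg (by omega), if_pos h, zero_add]
    · subst h; simp
    · rw [if_neg h.ne', if_pos h, if_neg (by omega), add_zero]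
  rw [Finset.sum_congr rfl (fun x _ => hsplit x), Finset.sum_add_distrib,
    ← Finset.sum_filter, ← Finset.sum_filter]
  have hf1 : (Finset.Icc (-(N : ℤ)) N).filter (fun x => 0 < x) = Finset.Icc (1 : ℤ) N := by
    ext x; simp only [Finset.mem_filter, Finset.mem_Icc]; omega
  have hf2 : (Finset.Icc (-(N : ℤ)) N).filter (fun x => x < 0) = Finset.Icc (-(N : ℤ)) (-1) := by
    ext x; simp only [Finset.mem_filter, Finset.mem_Icc]; omega
  rw [hf1, hf2, kfc_sum_Icc_neg_eq]
  have h1 : ∑ x ∈ Finset.Icc (1 : ℤ) N, (Int.gcd x b : ℝ) =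
      ∑ n ∈ Finset.Icc 1 N, (Nat.gcd n b : ℝ) := by
    rw [show (1 : ℤ) = ((1 : ℕ) : ℤ) by simp,
      ← kfc_sum_Icc_nat_eq_int 1 N (fun x => (Int.gcd x b : ℝ))]
    refine Finset.sum_congr rfl fun n _ => ?_
    rw [Int.gcd_natCast_natCast]
  have h2 : ∑ n ∈ Finset.Icc 1 N, (Int.gcd (-(n : ℤ)) b : ℝ) =
      ∑ n ∈ Finset.Icc 1 N, (Nat.gcd n b : ℝ) := by
    refine Finset.sum_congr rfl fun n _ => ?_
    rw [Int.neg_gcd, Int.gcd_natCast_natCast]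
  rw [h1, h2]
  have := MatomakiMerikoski.MatomakiMerikoski2023_lemma37_i hb.ne' N
  linarith

/-- `Σ_{d' ≠ d, 0 < |d'| ≤ D} (d - d', b) ≤ 4 τ(b) D` for `|d| ≤ D`. [folklore] -/
theorem kfc_sum_gcd_diff_le {b : ℕ} (hb : 0 < b) (D : ℕ) {d : ℤ}
    (hd : d ∈ (Finset.Icc (-(D : ℤ)) D).erase 0) :
    ∑ d' ∈ (Finset.Icc (-(D : ℤ)) D).erase 0,
      (if d = d' then (0 : ℝ) else (Int.gcd (d - d') b : ℝ)) ≤ 4 * (b.divisors.card : ℝ) * D := by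
  have hdD := Finset.mem_Icc.mp (Finset.mem_erase.mp hd).2
  set f : ℤ → ℝ := fun e => if e = 0 then 0 else (Int.gcd e b : ℝ) with hf
  have hre : ∑ d' ∈ (Finset.Icc (-(D : ℤ)) D).erase 0,
      (if d = d' then (0 : ℝ) else (Int.gcd (d - d') b : ℝ)) =
      ∑ e ∈ ((Finset.Icc (-(D : ℤ)) D).erase 0).image (fun d' => d - d'), f e := by
    rw [Finset.sum_image (fun x _ y _ h => by simpa using h)]
    refine Finset.sum_congr rfl fun d' _ => ?_
    simp only [hf, sub_eq_zero]
  rw [hre]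
  have hsub : ((Finset.Icc (-(D : ℤ)) D).erase 0).image (fun d' => d - d') ⊆
      Finset.Icc (-((2 * D : ℕ) : ℤ)) ((2 * D : ℕ) : ℤ) := by
    intro e he
    obtain ⟨d', hd', rfl⟩ := Finset.mem_image.mp he
    have hd'D := Finset.mem_Icc.mp (Finset.mem_erase.mp hd').2
    simp only [Finset.mem_Icc]
    push_cast
    constructor <;> omega
  have hnn : ∀ e ∈ Finset.Icc (-((2 * D : ℕ) : ℤ)) ((2 * D : ℕ) : ℤ), 0 ≤ f e := by
    intro e _; simp only [hf]; split_ifs <;> positivity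
  calc ∑ e ∈ ((Finset.Icc (-(D : ℤ)) D).erase 0).image (fun d' => d - d'), f e
      ≤ ∑ e ∈ Finset.Icc (-((2 * D : ℕ) : ℤ)) ((2 * D : ℕ) : ℤ), f e :=
        Finset.sum_le_sum_of_subset_of_nonneg hsub (fun e he _ => hnn e he)
    _ ≤ 2 * (b.divisors.card : ℝ) * ((2 * D : ℕ) : ℝ) := kfc_sum_gcd_Icc_int_le hb (2 * D)
    _ = 4 * (b.divisors.card : ℝ) * D := by push_cast; ring

/-- For `g ≥ 1` and `L < ℓ₁ ≤ 2L`: `g · #{ℓ₁' ∈ 𝓛 ∖ {ℓ₁} : g ∣ ℓ₁ - ℓ₁'} ≤ 2L`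
(`𝓛 ⊆ (L, 2L]`; the class of `ℓ₁` modulo `g` meets `(L,2L]` in at most `L/g + 1` points, and
`g ≤ |ℓ₁ - ℓ₁'| ≤ L` if the set is nonempty). [folklore] -/
theorem kfc_sum_moduli_le {L : ℕ} (𝓛 : Finset ℕ) (h𝓛 : ∀ ℓ ∈ 𝓛, L < ℓ ∧ ℓ ≤ 2 * L)
    {g : ℕ} (hg : 0 < g) {ℓ₁ : ℕ} (hℓ₁ : L < ℓ₁ ∧ ℓ₁ ≤ 2 * L) :
    ∑ ℓ₁' ∈ 𝓛, (if ℓ₁ = ℓ₁' then (0 : ℝ) else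
      (if (g : ℤ) ∣ ((ℓ₁ : ℤ) - ℓ₁') then (g : ℝ) else 0)) ≤ 2 * L := by
  classical
  set F := 𝓛.filter (fun ℓ₁' => ℓ₁ ≠ ℓ₁' ∧ (g : ℤ) ∣ ((ℓ₁ : ℤ) - ℓ₁')) with hF
  have hsum : ∑ ℓ₁' ∈ 𝓛, (if ℓ₁ = ℓ₁' then (0 : ℝ) else
      (if (g : ℤ) ∣ ((ℓ₁ : ℤ) - ℓ₁') then (g : ℝ) else 0)) = (g : ℝ) * F.card := by
    have : ∀ ℓ₁' ∈ 𝓛, (if ℓ₁ = ℓ₁' then (0 : ℝ) else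
        (if (g : ℤ) ∣ ((ℓ₁ : ℤ) - ℓ₁') then (g : ℝ) else 0)) =
        (if (ℓ₁ ≠ ℓ₁' ∧ (g : ℤ) ∣ ((ℓ₁ : ℤ) - ℓ₁')) then (g : ℝ) else 0) := by
      intro ℓ₁' _
      by_cases h1 : ℓ₁ = ℓ₁' <;> by_cases h2 : (g : ℤ) ∣ ((ℓ₁ : ℤ) - ℓ₁') <;> simp [h1, h2]
    rw [Finset.sum_congr rfl this, ← Finset.sum_filter, Finset.sum_const, nsmul_eq_mul, mul_comm]
  rw [hsum]
  rcases F.eq_empty_or_nonempty with h0 | ⟨ℓ₀, hℓ₀⟩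
  · rw [h0, Finset.card_empty, Nat.cast_zero, mul_zero]; positivity
  · have hℓ₀' := Finset.mem_filter.mp hℓ₀
    have hℓ₀L := h𝓛 ℓ₀ hℓ₀'.1
    -- `g ≤ L`
    have hgL : g ≤ L := by
      have hne : ((ℓ₁ : ℤ) - ℓ₀) ≠ 0 := by
        have := hℓ₀'.2.1; omega
      have h1 : (g : ℤ) ≤ |(ℓ₁ : ℤ) - ℓ₀| :=
        Int.le_of_dvd (abs_pos.mpr hne) ((dvd_abs _ _).mpr hℓ₀'.2.2)
      have h2 : |(ℓ₁ : ℤ) - ℓ₀| ≤ L := by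
        rw [abs_le]; constructor <;> omega
      omega
    -- `#F ≤ L/g + 1`
    have hmaps : ∀ ℓ₁' ∈ F, ((ℓ₁' : ℕ) : ℤ) ∈ (Finset.Ioc (L : ℤ) ((2 * L : ℕ) : ℤ)).filter
        (fun x => x ≡ (ℓ₁ : ℤ) [ZMOD g]) := by
      intro ℓ₁' hℓ₁'
      have h' := Finset.mem_filter.mp hℓ₁'
      have hL' := h𝓛 ℓ₁' h'.1
      refine Finset.mem_filter.mpr ⟨Finset.mem_Ioc.mpr ⟨by exact_mod_cast hL'.1,
        by exact_mod_cast hL'.2⟩, ?_⟩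
      exact Int.modEq_of_dvd h'.2.2
    have hinj : Set.InjOn (fun ℓ₁' : ℕ => ((ℓ₁' : ℕ) : ℤ)) F := by
      intro x _ y _ h
      have h' : ((x : ℕ) : ℤ) = ((y : ℕ) : ℤ) := h
      exact_mod_cast h' 
    have hcard := Finset.card_le_card_of_injOn (fun ℓ₁' : ℕ => ((ℓ₁' : ℕ) : ℤ))
      (by intro x hx; exact hmaps x (by simpa using hx)) hinj
    have hcls := kfc_card_Ioc_modEq_le (L : ℤ) ((2 * L : ℕ) : ℤ) (by push_cast; omega)
      (show (0 : ℤ) < g by exact_mod_cast hg) (ℓ₁ : ℤ)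
    have hF : (F.card : ℝ) ≤ (L : ℝ) / g + 1 := by
      calc (F.card : ℝ) ≤ (((Finset.Ioc (L : ℤ) ((2 * L : ℕ) : ℤ)).filter
            (fun x => x ≡ (ℓ₁ : ℤ) [ZMOD g])).card : ℝ) := by exact_mod_cast hcard
        _ ≤ _ := hcls
        _ = (L : ℝ) / g + 1 := by push_cast; ring
    have hg0 : (0 : ℝ) < g := by exact_mod_cast hg
    have hgL' : (g : ℝ) ≤ L := by exact_mod_cast hgL
    calc (g : ℝ) * F.card ≤ (g : ℝ) * ((L : ℝ) / g + 1) :=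
          mul_le_mul_of_nonneg_left hF hg0.le
      _ = L + g := by field_simp
      _ ≤ 2 * L := by linarith

/-- **The weighted pair count** (B–C §4.1.2–4.1.3, our bookkeeping): with `u = (d-d', b)` and
`λ = ℓ₁` if `ℓ₁ = ℓ₁'`, `1` otherwise,
`Σ_{(ℓ₁,d) ≠ (ℓ₁',d')} [u ∣ ℓ₁ - ℓ₁'] u λ ≤ 24 τ(b) L² D²`
(`ℓ₁, ℓ₁' ∈ 𝓛 ⊆ (L,2L]`, `0 < |d|, |d'| ≤ D`). [cite: BettinChandee2018, §4.1.2] -/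
theorem kfc_pair_weight_le {b : ℕ} (hb : 0 < b) {L : ℕ} (𝓛 : Finset ℕ)
    (h𝓛 : ∀ ℓ ∈ 𝓛, L < ℓ ∧ ℓ ≤ 2 * L) (D : ℕ) :
    ∑ ℓ₁ ∈ 𝓛, ∑ d ∈ (Finset.Icc (-(D : ℤ)) D).erase 0, ∑ ℓ₁' ∈ 𝓛,
      ∑ d' ∈ (Finset.Icc (-(D : ℤ)) D).erase 0,
      (if (ℓ₁, d) = (ℓ₁', d') then (0 : ℝ) else
        (if ((Int.gcd (d - d') b : ℕ) : ℤ) ∣ ((ℓ₁ : ℤ) - ℓ₁') then (Int.gcd (d - d') b : ℝ)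
          else 0) * (if ℓ₁ = ℓ₁' then (ℓ₁ : ℝ) else 1)) ≤
      24 * (b.divisors.card : ℝ) * (L : ℝ) ^ 2 * (D : ℝ) ^ 2 := by
  classical
  set Dset := (Finset.Icc (-(D : ℤ)) D).erase 0 with hDset
  set W₁ : ℕ → ℤ → ℕ → ℤ → ℝ := fun ℓ₁ d ℓ₁' d' =>
    if ℓ₁ = ℓ₁' then (ℓ₁ : ℝ) * (if d = d' then (0 : ℝ) else (Int.gcd (d - d') b : ℝ)) else 0
    with hW₁
  set W₂ : ℕ → ℤ → ℕ → ℤ → ℝ := fun ℓ₁ d ℓ₁' d' =>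
    if ℓ₁ = ℓ₁' then (0 : ℝ) else
      (if ((Int.gcd (d - d') b : ℕ) : ℤ) ∣ ((ℓ₁ : ℤ) - ℓ₁') then (Int.gcd (d - d') b : ℝ) else 0)
    with hW₂
  have hτ : (1 : ℝ) ≤ (b.divisors.card : ℝ) := by
    have : 0 < b.divisors.card := Finset.card_pos.mpr ⟨1, Nat.one_mem_divisors.mpr hb.ne'⟩
    exact_mod_cast this
  have hcardL : (𝓛.card : ℝ) ≤ L := by
    have : 𝓛 ⊆ Finset.Ioc L (2 * L) := fun ℓ hℓ => Finset.mem_Ioc.mpr (h𝓛 ℓ hℓ)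
    have h := Finset.card_le_card this
    rw [Nat.card_Ioc] at h
    have : 2 * L - L = L := by omega
    rw [this] at h
    exact_mod_cast h
  have hcardD : (Dset.card : ℝ) ≤ 2 * D := by
    have h1 : Dset.card ≤ 2 * D := by
      rw [hDset]
      have h0 : (0 : ℤ) ∈ Finset.Icc (-(D : ℤ)) D := by simp
      rw [Finset.card_erase_of_mem h0, Int.card_Icc]
      have : ((D : ℤ) + 1 - -(D : ℤ)).toNat = 2 * D + 1 := by omega
      rw [this]; omega
    exact_mod_cast h1
  -- pointwise split
  have hpt : ∀ ℓ₁ ∈ 𝓛, ∀ d ∈ Dset, ∀ ℓ₁' ∈ 𝓛, ∀ d' ∈ Dset,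
      (if (ℓ₁, d) = (ℓ₁', d') then (0 : ℝ) else
        (if ((Int.gcd (d - d') b : ℕ) : ℤ) ∣ ((ℓ₁ : ℤ) - ℓ₁') then (Int.gcd (d - d') b : ℝ)
          else 0) * (if ℓ₁ = ℓ₁' then (ℓ₁ : ℝ) else 1)) ≤
      W₁ ℓ₁ d ℓ₁' d' + W₂ ℓ₁ d ℓ₁' d' := by
    intro ℓ₁ _ d _ ℓ₁' _ d' _
    simp only [hW₁, hW₂]
    by_cases hp : (ℓ₁, d) = (ℓ₁', d')
    · rw [if_pos hp]
      obtain ⟨rfl, rfl⟩ := Prod.mk.injEq _ _ _ _ ▸ hp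
      simp
    · rw [if_neg hp]
      by_cases hl : ℓ₁ = ℓ₁'
      · subst hl
        have hdd : d ≠ d' := fun h => hp (by rw [h])
        simp [hdd, mul_comm]
      · simp [hl]
  -- sum of `W₁`
  have hS₁ : ∑ ℓ₁ ∈ 𝓛, ∑ d ∈ Dset, ∑ ℓ₁' ∈ 𝓛, ∑ d' ∈ Dset, W₁ ℓ₁ d ℓ₁' d' ≤
      16 * (b.divisors.card : ℝ) * (L : ℝ) ^ 2 * (D : ℝ) ^ 2 := by
    have hin : ∀ ℓ₁ ∈ 𝓛, ∀ d ∈ Dset, ∑ ℓ₁' ∈ 𝓛, ∑ d' ∈ Dset, W₁ ℓ₁ d ℓ₁' d' ≤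
        (2 * L) * (4 * (b.divisors.card : ℝ) * D) := by
      intro ℓ₁ hℓ₁ d hd
      have h1 : ∑ ℓ₁' ∈ 𝓛, ∑ d' ∈ Dset, W₁ ℓ₁ d ℓ₁' d' =
          (ℓ₁ : ℝ) * ∑ d' ∈ Dset, (if d = d' then (0 : ℝ) else (Int.gcd (d - d') b : ℝ)) := by
        have : ∀ ℓ₁' ∈ 𝓛, ∑ d' ∈ Dset, W₁ ℓ₁ d ℓ₁' d' = if ℓ₁ = ℓ₁' then
            (ℓ₁ : ℝ) * ∑ d' ∈ Dset, (if d = d' then (0 : ℝ) else (Int.gcd (d - d') b : ℝ))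
            else 0 := by
          intro ℓ₁' _
          simp only [hW₁]
          split_ifs with h
          · rw [Finset.mul_sum]
          · simp
        rw [Finset.sum_congr rfl this, Finset.sum_ite_eq, if_pos hℓ₁]
      rw [h1]
      have hℓ₁L : (ℓ₁ : ℝ) ≤ 2 * L := by exact_mod_cast (h𝓛 ℓ₁ hℓ₁).2
      have hg := kfc_sum_gcd_diff_le hb D hd
      have h0 : 0 ≤ ∑ d' ∈ Dset, (if d = d' then (0 : ℝ) else (Int.gcd (d - d') b : ℝ)) :=
        Finset.sum_nonneg fun d' _ => by split_ifs <;> positivity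
      exact mul_le_mul hℓ₁L hg h0 (by positivity)
    calc ∑ ℓ₁ ∈ 𝓛, ∑ d ∈ Dset, ∑ ℓ₁' ∈ 𝓛, ∑ d' ∈ Dset, W₁ ℓ₁ d ℓ₁' d'
        ≤ ∑ ℓ₁ ∈ 𝓛, ∑ d ∈ Dset, (2 * L) * (4 * (b.divisors.card : ℝ) * D) :=
          Finset.sum_le_sum fun ℓ₁ hℓ₁ => Finset.sum_le_sum fun d hd => hin ℓ₁ hℓ₁ d hd
      _ = (𝓛.card : ℝ) * ((Dset.card : ℝ) * ((2 * L) * (4 * (b.divisors.card : ℝ) * D))) := by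
          rw [Finset.sum_const, Finset.sum_const, nsmul_eq_mul, nsmul_eq_mul]
      _ ≤ (L : ℝ) * ((2 * D : ℝ) * ((2 * L) * (4 * (b.divisors.card : ℝ) * D))) := by
          have h0 : (0 : ℝ) ≤ (2 * L) * (4 * (b.divisors.card : ℝ) * D) := by positivity
          exact mul_le_mul hcardL (mul_le_mul_of_nonneg_right hcardD h0) (by positivity)
            (by positivity)
      _ = 16 * (b.divisors.card : ℝ) * (L : ℝ) ^ 2 * (D : ℝ) ^ 2 := by ring
  -- sum of `W₂`
  have hS₂ : ∑ ℓ₁ ∈ 𝓛, ∑ d ∈ Dset, ∑ ℓ₁' ∈ 𝓛, ∑ d' ∈ Dset, W₂ ℓ₁ d ℓ₁' d' ≤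
      8 * (L : ℝ) ^ 2 * (D : ℝ) ^ 2 := by
    have hin : ∀ ℓ₁ ∈ 𝓛, ∀ d ∈ Dset, ∑ ℓ₁' ∈ 𝓛, ∑ d' ∈ Dset, W₂ ℓ₁ d ℓ₁' d' ≤
        (2 * D : ℝ) * (2 * L) := by
      intro ℓ₁ hℓ₁ d _
      rw [Finset.sum_comm]
      calc ∑ d' ∈ Dset, ∑ ℓ₁' ∈ 𝓛, W₂ ℓ₁ d ℓ₁' d' ≤ ∑ d' ∈ Dset, (2 * L : ℝ) := by
            refine Finset.sum_le_sum fun d' _ => ?_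
            simp only [hW₂]
            exact kfc_sum_moduli_le 𝓛 h𝓛 (Int.gcd_pos_of_ne_zero_right _
              (by exact_mod_cast hb.ne')) (h𝓛 ℓ₁ hℓ₁)
        _ = (Dset.card : ℝ) * (2 * L) := by rw [Finset.sum_const, nsmul_eq_mul]
        _ ≤ (2 * D : ℝ) * (2 * L) := mul_le_mul_of_nonneg_right hcardD (by positivity)
    calc ∑ ℓ₁ ∈ 𝓛, ∑ d ∈ Dset, ∑ ℓ₁' ∈ 𝓛, ∑ d' ∈ Dset, W₂ ℓ₁ d ℓ₁' d'
        ≤ ∑ ℓ₁ ∈ 𝓛, ∑ d ∈ Dset, (2 * D : ℝ) * (2 * L) :=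
          Finset.sum_le_sum fun ℓ₁ hℓ₁ => Finset.sum_le_sum fun d hd => hin ℓ₁ hℓ₁ d hd
      _ = (𝓛.card : ℝ) * ((Dset.card : ℝ) * ((2 * D : ℝ) * (2 * L))) := by
          rw [Finset.sum_const, Finset.sum_const, nsmul_eq_mul, nsmul_eq_mul]
      _ ≤ (L : ℝ) * ((2 * D : ℝ) * ((2 * D : ℝ) * (2 * L))) := by
          exact mul_le_mul hcardL (mul_le_mul_of_nonneg_right hcardD (by positivity))
            (by positivity) (by positivity)
      _ = 8 * (L : ℝ) ^ 2 * (D : ℝ) ^ 2 := by ring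
  calc _ ≤ ∑ ℓ₁ ∈ 𝓛, ∑ d ∈ Dset, ∑ ℓ₁' ∈ 𝓛, ∑ d' ∈ Dset,
          (W₁ ℓ₁ d ℓ₁' d' + W₂ ℓ₁ d ℓ₁' d') :=
        Finset.sum_le_sum fun ℓ₁ hℓ₁ => Finset.sum_le_sum fun d hd =>
          Finset.sum_le_sum fun ℓ₁' hℓ₁' => Finset.sum_le_sum fun d' hd' =>
            hpt ℓ₁ hℓ₁ d hd ℓ₁' hℓ₁' d' hd'
    _ = ∑ ℓ₁ ∈ 𝓛, ∑ d ∈ Dset, ∑ ℓ₁' ∈ 𝓛, ∑ d' ∈ Dset, W₁ ℓ₁ d ℓ₁' d' +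
          ∑ ℓ₁ ∈ 𝓛, ∑ d ∈ Dset, ∑ ℓ₁' ∈ 𝓛, ∑ d' ∈ Dset, W₂ ℓ₁ d ℓ₁' d' := by
        simp only [Finset.sum_add_distrib]
    _ ≤ 16 * (b.divisors.card : ℝ) * (L : ℝ) ^ 2 * (D : ℝ) ^ 2 +
          8 * (L : ℝ) ^ 2 * (D : ℝ) ^ 2 := add_le_add hS₁ hS₂
    _ ≤ 24 * (b.divisors.card : ℝ) * (L : ℝ) ^ 2 * (D : ℝ) ^ 2 := by
        have : (0 : ℝ) ≤ (L : ℝ) ^ 2 * (D : ℝ) ^ 2 := by positivity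
        nlinarith

/-! ### Summing the Weil bound of a pair over `n₁` -/

set_option maxHeartbeats 800000 in
/-- Pointwise simplification of the bound of `kfw_pair_sum_le` for `N' < n₁ ≤ 2N'`
(`S = ℓ₁ℓ₁'n₁ ∈ [L²N', 8L²N']`, `|Y| ≤ 4DL`, `τ(S) ≤ T'`, `(Δ,n₁)^{1/2} ≤ (Δ,n₁)`).
[cite: BettinChandee2018, §4.1.3] -/
theorem kfc_rhs_pt_le (k : ℤ) {b : ℕ} (hb : 0 < b) {L : ℕ} (hL : 1 ≤ L) {ℓ₁ ℓ₁' ℓ₂ : ℕ}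
    (hℓ₁ : L < ℓ₁ ∧ ℓ₁ ≤ 2 * L) (hℓ₁' : L < ℓ₁' ∧ ℓ₁' ≤ 2 * L)
    {D : ℕ} {d d' : ℤ} (hd : d ∈ (Finset.Icc (-(D : ℤ)) D).erase 0)
    (hd' : d' ∈ (Finset.Icc (-(D : ℤ)) D).erase 0)
    (hΔ : (d * ℓ₁' - d' * ℓ₁) * ℓ₂ - (d - d') * (ℓ₁ * ℓ₁' : ℕ) ≠ 0)
    {N' : ℝ} (hN' : 1 / 2 ≤ N') {T' : ℝ}
    (hT' : ∀ w : ℕ, 1 ≤ w → (w : ℝ) ≤ 16 * (L : ℝ) ^ 2 * (N' + D) → (w.divisors.card : ℝ) ≤ T')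
    {n₁ : ℕ} (hn₁N : N' < n₁) (hn₁le : (n₁ : ℝ) ≤ 2 * N') :
    2 * (1 + 2 * Real.pi * |(k : ℝ)| * |((d * ℓ₁' - d' * ℓ₁ : ℤ) : ℝ)| /
          ((b : ℝ) * (ℓ₁ * ℓ₁' * n₁ : ℕ) * ((⌊N'⌋₊ : ℝ) + 1))) *
        (((⌊2 * N'⌋₊ : ℝ) - ⌊N'⌋₊ + 3) *
            (Int.gcd ((d * ℓ₁' - d' * ℓ₁) * ℓ₂ - (d - d') * (ℓ₁ * ℓ₁' : ℕ)) n₁ : ℝ) / n₁ +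
          ((ℓ₁ * ℓ₁' * n₁ : ℕ).divisors.card : ℝ) * Real.sqrt ((ℓ₁ * ℓ₁' * n₁ : ℕ) : ℝ) *
            (if ℓ₁ = ℓ₁' then (ℓ₁ : ℝ) else 1) *
            Real.sqrt (Int.gcd ((d * ℓ₁' - d' * ℓ₁) * ℓ₂ - (d - d') * (ℓ₁ * ℓ₁' : ℕ)) n₁ : ℝ) *
            (1 + Real.log ((ℓ₁ * ℓ₁' * n₁ : ℕ) : ℝ))) ≤
      (Int.gcd ((d * ℓ₁' - d' * ℓ₁) * ℓ₂ - (d - d') * (ℓ₁ * ℓ₁' : ℕ)) n₁ : ℝ) *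
        ((if ℓ₁ = ℓ₁' then (ℓ₁ : ℝ) else 1) *
          (2 * (1 + 8 * Real.pi * |(k : ℝ)| * D / ((b : ℝ) * L * N' ^ 2)) *
            ((N' + 4) / N' + T' * L * Real.sqrt (8 * N') *
              (1 + Real.log (8 * (L : ℝ) ^ 2 * N'))))) := by
  set Δ : ℤ := (d * ℓ₁' - d' * ℓ₁) * ℓ₂ - (d - d') * (ℓ₁ * ℓ₁' : ℕ) with hΔdef
  set lam : ℝ := (if ℓ₁ = ℓ₁' then (ℓ₁ : ℝ) else 1) with hlam
  set F : ℝ := 1 + 8 * Real.pi * |(k : ℝ)| * D / ((b : ℝ) * L * N' ^ 2) with hF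
  set TB : ℝ := T' * L * Real.sqrt (8 * N') * (1 + Real.log (8 * (L : ℝ) ^ 2 * N')) with hTB
  set S : ℕ := ℓ₁ * ℓ₁' * n₁ with hS
  set g : ℕ := Int.gcd Δ n₁ with hg
  -- basic facts
  have hN'0 : 0 < N' := by linarith
  have hL0 : (0 : ℝ) < L := by exact_mod_cast hL
  have hL1 : (1 : ℝ) ≤ L := by exact_mod_cast hL
  have hb0 : (0 : ℝ) < b := by exact_mod_cast hb
  have hdD := Finset.mem_Icc.mp (Finset.mem_erase.mp hd).2
  have hdD' := Finset.mem_Icc.mp (Finset.mem_erase.mp hd').2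
  have hD0 : (0 : ℝ) ≤ D := Nat.cast_nonneg _
  have hdR : |(d : ℝ)| ≤ D := by
    rw [abs_le]; constructor
    · exact_mod_cast hdD.1
    · exact_mod_cast hdD.2
  have hdR' : |(d' : ℝ)| ≤ D := by
    rw [abs_le]; constructor
    · exact_mod_cast hdD'.1
    · exact_mod_cast hdD'.2
  have hℓ₁R : (ℓ₁ : ℝ) ≤ 2 * L := by exact_mod_cast hℓ₁.2
  have hℓ₁'R : (ℓ₁' : ℝ) ≤ 2 * L := by exact_mod_cast hℓ₁'.2
  have hLℓ₁ : (L : ℝ) ≤ ℓ₁ := by exact_mod_cast hℓ₁.1.le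
  have hLℓ₁' : (L : ℝ) ≤ ℓ₁' := by exact_mod_cast hℓ₁'.1.le
  have hn₁R : (0 : ℝ) < n₁ := hN'0.trans hn₁N
  have hn₁pos : 0 < n₁ := by exact_mod_cast hn₁R
  have hT'1 : 1 ≤ T' := by
    have h := hT' 1 le_rfl (by
      push_cast
      have : (1 : ℝ) ≤ (L : ℝ) ^ 2 := by nlinarith
      nlinarith)
    simpa using h
  have hT'0 : 0 ≤ T' := by linarith
  have hF1 : 1 ≤ F := by
    rw [hF]
    have : 0 ≤ 8 * Real.pi * |(k : ℝ)| * D / ((b : ℝ) * L * N' ^ 2) := by positivity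
    linarith
  have hlam1 : 1 ≤ lam := by
    rw [hlam]; split_ifs
    · have : 1 ≤ ℓ₁ := by omega
      exact_mod_cast this
    · exact le_rfl
  have hlam0 : 0 ≤ lam := by linarith
  have hlog8 : 0 ≤ Real.log (8 * (L : ℝ) ^ 2 * N') := by
    refine Real.log_nonneg ?_
    have : (1 : ℝ) ≤ (L : ℝ) ^ 2 := by nlinarith
    nlinarith
  have hTB0 : 0 ≤ TB := by rw [hTB]; positivity
  -- `|Y| ≤ 4 D L`
  have hY : |((d * ℓ₁' - d' * ℓ₁ : ℤ) : ℝ)| ≤ 4 * D * L := by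
    push_cast
    calc |(d : ℝ) * ℓ₁' - d' * ℓ₁| ≤ |(d : ℝ) * ℓ₁'| + |(d' : ℝ) * ℓ₁| := abs_sub _ _
      _ = |(d : ℝ)| * ℓ₁' + |(d' : ℝ)| * ℓ₁ := by
          rw [abs_mul, abs_mul, Nat.abs_cast, Nat.abs_cast]
      _ ≤ D * (2 * L) + D * (2 * L) :=
          add_le_add (mul_le_mul hdR hℓ₁'R (Nat.cast_nonneg _) hD0)
            (mul_le_mul hdR' hℓ₁R (Nat.cast_nonneg _) hD0)
      _ = 4 * D * L := by ring
  -- `S`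
  have hSR : (S : ℝ) = ℓ₁ * ℓ₁' * n₁ := by rw [hS]; push_cast; ring
  have hS1 : 1 ≤ S := Nat.mul_pos (Nat.mul_pos (by omega) (by omega)) hn₁pos
  have hS0R : (0 : ℝ) < S := by exact_mod_cast hS1
  have hSlo : (L : ℝ) ^ 2 * N' ≤ S := by
    rw [hSR, sq]
    exact mul_le_mul (mul_le_mul hLℓ₁ hLℓ₁' hL0.le (Nat.cast_nonneg _)) hn₁N.le hN'0.le
      (by positivity)
  have hShi : (S : ℝ) ≤ 8 * (L : ℝ) ^ 2 * N' := by
    rw [hSR]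
    calc (ℓ₁ : ℝ) * ℓ₁' * n₁ ≤ (2 * L) * (2 * L) * (2 * N') :=
          mul_le_mul (mul_le_mul hℓ₁R hℓ₁'R (Nat.cast_nonneg _) (by positivity)) hn₁le
            hn₁R.le (by positivity)
      _ = 8 * (L : ℝ) ^ 2 * N' := by ring
  have hτS : (S.divisors.card : ℝ) ≤ T' := hT' S hS1 (hShi.trans (by nlinarith))
  have hsqrtS : Real.sqrt S ≤ L * Real.sqrt (8 * N') := by
    have e : (L : ℝ) * Real.sqrt (8 * N') = Real.sqrt (8 * (L : ℝ) ^ 2 * N') := by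
      rw [show (8 : ℝ) * (L : ℝ) ^ 2 * N' = (L : ℝ) ^ 2 * (8 * N') by ring,
        Real.sqrt_mul (sq_nonneg _), Real.sqrt_sq hL0.le]
    rw [e]
    exact Real.sqrt_le_sqrt hShi
  have hlogS : Real.log S ≤ Real.log (8 * (L : ℝ) ^ 2 * N') := Real.log_le_log hS0R hShi
  have hlogS0 : 0 ≤ Real.log S := Real.log_nonneg (by exact_mod_cast hS1)
  -- `g`
  have hg1 : 1 ≤ g := Int.gcd_pos_of_ne_zero_left _ hΔ
  have hgR : (1 : ℝ) ≤ g := by exact_mod_cast hg1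
  have hg0 : (0 : ℝ) ≤ g := by linarith
  have hgg : (g : ℝ) ≤ (g : ℝ) ^ 2 := by
    calc (g : ℝ) = g * 1 := (mul_one _).symm
      _ ≤ g * g := mul_le_mul_of_nonneg_left hgR hg0
      _ = (g : ℝ) ^ 2 := (sq _).symm
  have hsqrtg : Real.sqrt g ≤ g := by
    calc Real.sqrt g ≤ Real.sqrt ((g : ℝ) ^ 2) := Real.sqrt_le_sqrt hgg
      _ = g := Real.sqrt_sq hg0
  -- the `k`-factor
  have hfac : 1 + 2 * Real.pi * |(k : ℝ)| * |((d * ℓ₁' - d' * ℓ₁ : ℤ) : ℝ)| /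
      ((b : ℝ) * (S : ℕ) * ((⌊N'⌋₊ : ℝ) + 1)) ≤ F := by
    rw [hF]
    have hN1 : N' ≤ (⌊N'⌋₊ : ℝ) + 1 := (Nat.lt_floor_add_one N').le
    have hdenpos : 0 < (b : ℝ) * ((L : ℝ) ^ 2 * N') * N' := by positivity
    have hden : (b : ℝ) * ((L : ℝ) ^ 2 * N') * N' ≤ (b : ℝ) * (S : ℕ) * ((⌊N'⌋₊ : ℝ) + 1) :=
      mul_le_mul (mul_le_mul_of_nonneg_left hSlo hb0.le) hN1 hN'0.le (by positivity)
    have h1 : 2 * Real.pi * |(k : ℝ)| * |((d * ℓ₁' - d' * ℓ₁ : ℤ) : ℝ)| /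
        ((b : ℝ) * (S : ℕ) * ((⌊N'⌋₊ : ℝ) + 1)) ≤
        2 * Real.pi * |(k : ℝ)| * (4 * D * L) / ((b : ℝ) * ((L : ℝ) ^ 2 * N') * N') :=
      div_le_div₀ (by positivity) (mul_le_mul_of_nonneg_left hY (by positivity)) hdenpos hden
    have h2 : 2 * Real.pi * |(k : ℝ)| * (4 * D * L) / ((b : ℝ) * ((L : ℝ) ^ 2 * N') * N') =
        8 * Real.pi * |(k : ℝ)| * D / ((b : ℝ) * L * N' ^ 2) := by
      field_simp
      ring
    linarith
  have hfac0 : 0 ≤ 1 + 2 * Real.pi * |(k : ℝ)| * |((d * ℓ₁' - d' * ℓ₁ : ℤ) : ℝ)| /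
      ((b : ℝ) * (S : ℕ) * ((⌊N'⌋₊ : ℝ) + 1)) := by positivity
  -- term A
  have hA : ((⌊2 * N'⌋₊ : ℝ) - ⌊N'⌋₊ + 3) * (g : ℝ) / n₁ ≤ (g : ℝ) * ((N' + 4) / N') := by
    have h1 : (⌊2 * N'⌋₊ : ℝ) - ⌊N'⌋₊ + 3 ≤ N' + 4 := by
      have := Nat.floor_le (show 0 ≤ 2 * N' by linarith)
      have := Nat.lt_floor_add_one N'
      linarith
    have h2 : ((⌊2 * N'⌋₊ : ℝ) - ⌊N'⌋₊ + 3) * g / n₁ ≤ (N' + 4) * g / n₁ :=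
      div_le_div_of_nonneg_right (mul_le_mul_of_nonneg_right h1 hg0) hn₁R.le
    have h3 : (N' + 4) * g / n₁ ≤ (N' + 4) * g / N' :=
      div_le_div_of_nonneg_left (by positivity) hN'0 hn₁N.le
    calc _ ≤ (N' + 4) * g / N' := h2.trans h3
      _ = g * ((N' + 4) / N') := by ring
  have hA0 : 0 ≤ ((⌊2 * N'⌋₊ : ℝ) - ⌊N'⌋₊ + 3) * (g : ℝ) / n₁ := by
    have h1 : 0 ≤ (⌊2 * N'⌋₊ : ℝ) - ⌊N'⌋₊ + 3 := by
      have : (⌊N'⌋₊ : ℝ) ≤ ⌊2 * N'⌋₊ := by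
        exact_mod_cast Nat.floor_le_floor (by linarith : N' ≤ 2 * N')
      linarith
    positivity
  -- term B
  have hB : (S.divisors.card : ℝ) * Real.sqrt S * lam * Real.sqrt g * (1 + Real.log S) ≤
      (g : ℝ) * (lam * TB) := by
    calc (S.divisors.card : ℝ) * Real.sqrt S * lam * Real.sqrt g * (1 + Real.log S)
        ≤ T' * (L * Real.sqrt (8 * N')) * lam * g * (1 + Real.log (8 * (L : ℝ) ^ 2 * N')) := by
          refine mul_le_mul (mul_le_mul (mul_le_mul_of_nonneg_right (mul_le_mul hτS hsqrtS
            (Real.sqrt_nonneg _) hT'0) hlam0) hsqrtg (Real.sqrt_nonneg _) (by positivity))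
            (by linarith) (by linarith) (by positivity)
      _ = (g : ℝ) * (lam * TB) := by rw [hTB]; ring
  have hB0 : 0 ≤ (S.divisors.card : ℝ) * Real.sqrt S * lam * Real.sqrt g * (1 + Real.log S) := by
    positivity
  -- combine
  calc 2 * (1 + 2 * Real.pi * |(k : ℝ)| * |((d * ℓ₁' - d' * ℓ₁ : ℤ) : ℝ)| /
          ((b : ℝ) * (S : ℕ) * ((⌊N'⌋₊ : ℝ) + 1))) *
        (((⌊2 * N'⌋₊ : ℝ) - ⌊N'⌋₊ + 3) * (g : ℝ) / n₁ +
          (S.divisors.card : ℝ) * Real.sqrt S * lam * Real.sqrt g * (1 + Real.log S))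
      ≤ 2 * F * ((g : ℝ) * ((N' + 4) / N') + (g : ℝ) * (lam * TB)) :=
        mul_le_mul (mul_le_mul_of_nonneg_left hfac (by norm_num)) (add_le_add hA hB)
          (add_nonneg hA0 hB0) (by positivity)
    _ ≤ 2 * F * ((g : ℝ) * (lam * ((N' + 4) / N')) + (g : ℝ) * (lam * TB)) := by
        have h1 : (g : ℝ) * ((N' + 4) / N') ≤ (g : ℝ) * (lam * ((N' + 4) / N')) :=
          mul_le_mul_of_nonneg_left (le_mul_of_one_le_left (by positivity) hlam1) hg0
        have h2 : (0 : ℝ) ≤ 2 * F := by positivity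
        exact mul_le_mul_of_nonneg_left (add_le_add h1 le_rfl) h2
    _ = (g : ℝ) * (lam * (2 * F * ((N' + 4) / N' + TB))) := by ring

set_option maxHeartbeats 800000 in
/-- **Summing the pair bound over `n₁`** (B–C §4.1.3 after (boudn): summing over `n₁'` with
`Σ_{n₁ ≤ 2N'} (Δ, n₁) ≤ τ(|Δ|) · 2N'`): for a pair with `Δ' ≠ 0`, the bound of
`kfw_pair_sum_le` (with `N₁ = ⌊N'⌋`, `N₂ = ⌊2N'⌋`) summed over `n₁ ∈ I' ⊆ [1, 2N']`, `n₁ > N'`,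
is at most `λ · 4T'N'(1 + 8π|k|D/(bLN'²))((N'+4)/N' + T' L (8N')^{1/2} (1 + log(8L²N')))`.
[cite: BettinChandee2018, §4.1.3] -/
theorem kfc_rhs_sum_le (k : ℤ) {b : ℕ} (hb : 0 < b) {L : ℕ} (hL : 1 ≤ L) {ℓ₁ ℓ₁' ℓ₂ : ℕ}
    (hℓ₁ : L < ℓ₁ ∧ ℓ₁ ≤ 2 * L) (hℓ₁' : L < ℓ₁' ∧ ℓ₁' ≤ 2 * L) (hℓ₂ : L < ℓ₂ ∧ ℓ₂ ≤ 2 * L)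
    {D : ℕ} {d d' : ℤ} (hd : d ∈ (Finset.Icc (-(D : ℤ)) D).erase 0)
    (hd' : d' ∈ (Finset.Icc (-(D : ℤ)) D).erase 0)
    (hΔ : (d * ℓ₁' - d' * ℓ₁) * ℓ₂ - (d - d') * (ℓ₁ * ℓ₁' : ℕ) ≠ 0)
    {N' : ℝ} (hN' : 1 / 2 ≤ N') {T' : ℝ}
    (hT' : ∀ w : ℕ, 1 ≤ w → (w : ℝ) ≤ 16 * (L : ℝ) ^ 2 * (N' + D) → (w.divisors.card : ℝ) ≤ T')
    (I' : Finset ℕ) (hI' : I' ⊆ Finset.Icc 1 ⌊2 * N'⌋₊) (hI'N : ∀ n ∈ I', N' < n) :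
    ∑ n₁ ∈ I',
      2 * (1 + 2 * Real.pi * |(k : ℝ)| * |((d * ℓ₁' - d' * ℓ₁ : ℤ) : ℝ)| /
          ((b : ℝ) * (ℓ₁ * ℓ₁' * n₁ : ℕ) * ((⌊N'⌋₊ : ℝ) + 1))) *
        (((⌊2 * N'⌋₊ : ℝ) - ⌊N'⌋₊ + 3) *
            (Int.gcd ((d * ℓ₁' - d' * ℓ₁) * ℓ₂ - (d - d') * (ℓ₁ * ℓ₁' : ℕ)) n₁ : ℝ) / n₁ +
          ((ℓ₁ * ℓ₁' * n₁ : ℕ).divisors.card : ℝ) * Real.sqrt ((ℓ₁ * ℓ₁' * n₁ : ℕ) : ℝ) *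
            (if ℓ₁ = ℓ₁' then (ℓ₁ : ℝ) else 1) *
            Real.sqrt (Int.gcd ((d * ℓ₁' - d' * ℓ₁) * ℓ₂ - (d - d') * (ℓ₁ * ℓ₁' : ℕ)) n₁ : ℝ) *
            (1 + Real.log ((ℓ₁ * ℓ₁' * n₁ : ℕ) : ℝ))) ≤
      (if ℓ₁ = ℓ₁' then (ℓ₁ : ℝ) else 1) *
        (4 * T' * N' * (1 + 8 * Real.pi * |(k : ℝ)| * D / ((b : ℝ) * L * N' ^ 2)) *
          ((N' + 4) / N' + T' * L * Real.sqrt (8 * N') *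
            (1 + Real.log (8 * (L : ℝ) ^ 2 * N')))) := by
  set Δ : ℤ := (d * ℓ₁' - d' * ℓ₁) * ℓ₂ - (d - d') * (ℓ₁ * ℓ₁' : ℕ) with hΔdef
  set lam : ℝ := (if ℓ₁ = ℓ₁' then (ℓ₁ : ℝ) else 1) with hlam
  set F : ℝ := 1 + 8 * Real.pi * |(k : ℝ)| * D / ((b : ℝ) * L * N' ^ 2) with hF
  set C₁ : ℝ := (N' + 4) / N' + T' * L * Real.sqrt (8 * N') *
    (1 + Real.log (8 * (L : ℝ) ^ 2 * N')) with hC₁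
  have hN'0 : 0 < N' := by linarith
  have hL0 : (0 : ℝ) < L := by exact_mod_cast hL
  have hL1 : (1 : ℝ) ≤ L := by exact_mod_cast hL
  have hdD := Finset.mem_Icc.mp (Finset.mem_erase.mp hd).2
  have hdD' := Finset.mem_Icc.mp (Finset.mem_erase.mp hd').2
  have hD0 : (0 : ℝ) ≤ D := Nat.cast_nonneg _
  have hT'1 : 1 ≤ T' := by
    have h := hT' 1 le_rfl (by
      push_cast
      have : (1 : ℝ) ≤ (L : ℝ) ^ 2 := by nlinarith
      nlinarith)
    simpa using h
  have hF1 : 1 ≤ F := by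
    rw [hF]
    have : 0 ≤ 8 * Real.pi * |(k : ℝ)| * D / ((b : ℝ) * L * N' ^ 2) := by positivity
    linarith
  have hlam1 : 1 ≤ lam := by
    rw [hlam]; split_ifs
    · have : 1 ≤ ℓ₁ := by omega
      exact_mod_cast this
    · exact le_rfl
  have hlog8 : 0 ≤ Real.log (8 * (L : ℝ) ^ 2 * N') := by
    refine Real.log_nonneg ?_
    have : (1 : ℝ) ≤ (L : ℝ) ^ 2 := by nlinarith
    nlinarith
  have hC₁0 : 0 ≤ C₁ := by rw [hC₁]; positivity
  -- `|Δ| ≤ 16 D L² ≤ 16 L² (N' + D)` and `τ(|Δ|) ≤ T'`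
  have hdR : |(d : ℝ)| ≤ D := by
    rw [abs_le]; constructor
    · exact_mod_cast hdD.1
    · exact_mod_cast hdD.2
  have hdR' : |(d' : ℝ)| ≤ D := by
    rw [abs_le]; constructor
    · exact_mod_cast hdD'.1
    · exact_mod_cast hdD'.2
  have hℓ₁R : (ℓ₁ : ℝ) ≤ 2 * L := by exact_mod_cast hℓ₁.2
  have hℓ₁'R : (ℓ₁' : ℝ) ≤ 2 * L := by exact_mod_cast hℓ₁'.2
  have hℓ₂R : (ℓ₂ : ℝ) ≤ 2 * L := by exact_mod_cast hℓ₂.2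
  have hYR : |(d : ℝ) * ℓ₁' - d' * ℓ₁| ≤ 4 * D * L := by
    calc |(d : ℝ) * ℓ₁' - d' * ℓ₁| ≤ |(d : ℝ) * ℓ₁'| + |(d' : ℝ) * ℓ₁| := abs_sub _ _
      _ = |(d : ℝ)| * ℓ₁' + |(d' : ℝ)| * ℓ₁ := by
          rw [abs_mul, abs_mul, Nat.abs_cast, Nat.abs_cast]
      _ ≤ D * (2 * L) + D * (2 * L) :=
          add_le_add (mul_le_mul hdR hℓ₁'R (Nat.cast_nonneg _) hD0)
            (mul_le_mul hdR' hℓ₁R (Nat.cast_nonneg _) hD0)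
      _ = 4 * D * L := by ring
  have hΔR : ((Δ.natAbs : ℕ) : ℝ) ≤ 16 * (L : ℝ) ^ 2 * (N' + D) := by
    have h1 : ((Δ.natAbs : ℕ) : ℝ) = |(Δ : ℝ)| := by
      rw [← Int.cast_natCast (R := ℝ) Δ.natAbs, Int.natCast_natAbs, Int.cast_abs]
    rw [h1, hΔdef]
    push_cast
    calc |((d : ℝ) * ℓ₁' - d' * ℓ₁) * ℓ₂ - (d - d') * (ℓ₁ * ℓ₁')|
        ≤ |((d : ℝ) * ℓ₁' - d' * ℓ₁) * ℓ₂| + |((d : ℝ) - d') * (ℓ₁ * ℓ₁')| := abs_sub _ _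
      _ = |(d : ℝ) * ℓ₁' - d' * ℓ₁| * ℓ₂ + |(d : ℝ) - d'| * (ℓ₁ * ℓ₁') := by
          rw [abs_mul, abs_mul, Nat.abs_cast,
            abs_of_nonneg (by positivity : (0 : ℝ) ≤ (ℓ₁ : ℝ) * ℓ₁')]
      _ ≤ (4 * D * L) * (2 * L) + (D + D) * (2 * L * (2 * L)) :=
          add_le_add (mul_le_mul hYR hℓ₂R (Nat.cast_nonneg _) (by positivity))
            (mul_le_mul ((abs_sub _ _).trans (add_le_add hdR hdR'))
              (mul_le_mul hℓ₁R hℓ₁'R (Nat.cast_nonneg _) (by positivity))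
              (by positivity) (by positivity))
      _ = 16 * D * (L : ℝ) ^ 2 := by ring
      _ ≤ 16 * (L : ℝ) ^ 2 * (N' + D) := by nlinarith [sq_nonneg (L : ℝ)]
  have hτΔ : ((Δ.natAbs).divisors.card : ℝ) ≤ T' := hT' _ (Int.natAbs_pos.mpr hΔ) hΔR
  -- the gcd sum
  have hgsum : ∑ n₁ ∈ I', (Int.gcd Δ n₁ : ℝ) ≤ T' * (2 * N') := by
    calc ∑ n₁ ∈ I', (Int.gcd Δ n₁ : ℝ)
        ≤ ∑ n₁ ∈ Finset.Icc 1 ⌊2 * N'⌋₊, (Int.gcd Δ n₁ : ℝ) :=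
          Finset.sum_le_sum_of_subset_of_nonneg hI' (fun _ _ _ => Nat.cast_nonneg _)
      _ = ∑ n₁ ∈ Finset.Icc 1 ⌊2 * N'⌋₊, (Nat.gcd n₁ Δ.natAbs : ℝ) := by
          refine Finset.sum_congr rfl fun n₁ _ => ?_
          rw [Int.gcd_eq_natAbs, Int.natAbs_natCast, Nat.gcd_comm]
      _ ≤ ((Δ.natAbs).divisors.card : ℝ) * ⌊2 * N'⌋₊ :=
          MatomakiMerikoski.MatomakiMerikoski2023_lemma37_i (Int.natAbs_ne_zero.mpr hΔ) _
      _ ≤ T' * (2 * N') :=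
          mul_le_mul hτΔ (Nat.floor_le (by linarith)) (Nat.cast_nonneg _) (by linarith)
  -- pointwise and sum
  have hpt : ∀ n₁ ∈ I', _ := fun n₁ hn₁ =>
    kfc_rhs_pt_le k hb hL hℓ₁ hℓ₁' (ℓ₂ := ℓ₂) hd hd' hΔ hN' hT' (hI'N n₁ hn₁)
      ((Nat.cast_le.mpr (Finset.mem_Icc.mp (hI' hn₁)).2).trans (Nat.floor_le (by linarith)))
  calc _ ≤ ∑ n₁ ∈ I', (Int.gcd Δ n₁ : ℝ) * (lam * (2 * F * C₁)) := Finset.sum_le_sum hpt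
    _ = (∑ n₁ ∈ I', (Int.gcd Δ n₁ : ℝ)) * (lam * (2 * F * C₁)) := by rw [Finset.sum_mul]
    _ ≤ (T' * (2 * N')) * (lam * (2 * F * C₁)) :=
        mul_le_mul_of_nonneg_right hgsum (by positivity)
    _ = lam * (4 * T' * N' * F * C₁) := by ring

end Literature.NumberTheory.LFunctions

end
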